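import Summits.QuantumFields.YangMills.Theorems.BalabanLadderNTMarkovMirrorBareTypical
import HarnessLib

/-!
# Crux `UVSeamRec` (stmt-QuantumFields-20043), stub `stub_floorsEngine` (S-B) / crux `NT` clause (i):
# asymptotic packaging of the measure-typical clause-(i) package {MF, RBLΔ-L²}

Helper file (`--supports stmt-QuantumFields-20043`) of the seam stub-prover row `ym-20043-seam-s1` (owner RULING
R75), sequel of `…NTMarkovMirrorBareTypical` (per coupling and torus: `Q2_ge_of_bareFloor_l2`,
`bareFloor_of_Q2_floor_l2`).  Along a unit map `a > 0` with ONE test function `v` and a positive-time cube family of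
physical size `≤ Λ₅` carrying the lattice support of `v(aβ·)` at depth `≥ 2`:

* (MF)      `9ε/4 ≤ Cov_T(Ṽ_v∘Θ₀, Ṽ_v)` on every torus `aβ·L ≥ Λ₅`;
* (RBLΔ-L²) `∫ |kerE_{Q_β}^{lift U}(Wᴿ_v) − kerE_{Q_β}^{lift U}(Ṽ_v) − p' β|² dμ_T(U) ≤ ε/4` on every such torus

give `Q2_floor_of_bareFloor_l2` (`ε ≤ Q2_{β,L,aβ}(θv, v)` for `β ≥ max β₅ 0`), `lowerBounds_fst_of_bareFloor_l2`
(clause (i) of `LowerBounds G r a`), `floorsTwoPoint_of_bareFloor_l2` (the two-point conjunct of the registered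
`UVSeamRec.stub_floorsEngine`, v4-F f523973980851859, for any `(G, r, a)`), `nt_of_bareFloor_l2`
(`Theses.BalabanLadder.NT` BY NAME, given any clause-(ii) supplier), and the converse `bareFloors_of_Q2_floors_l2`.
`torusE_sq_le_of_goodLaw_and_rarity` feeds (RBLΔ-L²) from a TEMPERED supplier (law on a measurable good set of
exteriors + `μ_T`-rarity).  Measure-typical = the form the fleet lead's kit finding (ym-spine-20043-p1 g7: no `∀`-exterior one-point law with
depth-decaying tolerance survives self-dual uniform flux) leaves standing.  Nothing here is `SU(2)`-specific.
Honest status: bookkeeping; (MF), (RBLΔ-L²)'s supplier and clause (ii) are engine-grade (crux `NT` / E0′-type ceilings).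
-/

set_option autoImplicit false

noncomputable section

open scoped SchwartzMap
open MeasureTheory Filter Topology
open Literature.MathematicalPhysics.QuantumFieldTheory Literature.MathematicalPhysics.QuantumLattice
open Literature.Probability.LatticeModels
open Summit.QuantumFields.YangMills.Cruxes.OSLegsFromFemtoAndGap.DlrCollarTransfer
open Summit.QuantumFields.YangMills.Cruxes.NT.Reflection (integrable_wilson_of_bdd)

namespace Summit.QuantumFields.YangMills.Cruxes.NT.MarkovMirror

section TypicalPackage

variable (G : Type) [Group G] [TopologicalSpace G] [IsTopologicalGroup G] [CompactSpace G]
  [MeasurableSpace G] [BorelSpace G] (r : LatticeRep G)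

/-! ## §0 Feeding (RBLΔ-L²) from a tempered supplier: good exteriors + rarity -/

/-- **Mean square from a good-set law and rarity.**  For a bounded continuous `Φ` on `ℤ⁴` configurations
(`|Φ| ≤ M`), a measurable set `Good` of exteriors with `|Φ| ≤ δ` on `Good`, and the rarity bound
`E_T[𝟙_{Goodᶜ}∘lift] ≤ η₀` on the torus `2L+1`: `E_T[Φ²∘lift] ≤ δ² + M²·η₀`.  This is how the mean-square defect
hypothesis (RBLΔ-L²) of `Q2_ge_of_bareFloor_l2` is fed by a TEMPERED supplier (a law on good exteriors plus a
`μ_T`-rarity bound, the currency of `…UVSeamRecCeilingsDefectCollarMoments`), never by a `∀`-exterior law. [folklore] -/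
theorem torusE_sq_le_of_goodLaw_and_rarity (β : ℝ) (L : ℕ) {Φ : LGConfig 4 G → ℝ} (hΦc : Continuous Φ)
    {M : ℝ} (hM : ∀ U, |Φ U| ≤ M) (Good : Set (LGConfig 4 G)) (hGood : MeasurableSet Good)
    {δ η₀ : ℝ} (hlaw : ∀ U ∈ Good, |Φ U| ≤ δ)
    (hrare : torusE G r β L (Goodᶜ.indicator fun _ => (1 : ℝ)) ≤ η₀) :
    torusE G r β L (fun V => Φ V ^ 2) ≤ δ ^ 2 + M ^ 2 * η₀ := by
  classical
  haveI := r.secondCountableTopology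
  haveI := isProbabilityMeasure_wilsonMeasure (d := 4) (L := 2 * L + 1) r.ρ r.continuous β
  set χ : LGConfig 4 G → ℝ := Goodᶜ.indicator fun _ => (1 : ℝ) with hχ
  have hχ0 : ∀ V, 0 ≤ χ V := fun V => Set.indicator_nonneg (fun _ _ => zero_le_one) _
  have hχ1 : ∀ V, χ V ≤ 1 := fun V => Set.indicator_apply_le' (fun _ => le_rfl) (fun _ => zero_le_one)
  have hptw : ∀ V : LGConfig 4 G, Φ V ^ 2 ≤ δ ^ 2 + M ^ 2 * χ V := fun V => by
    by_cases hV : V ∈ Good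
    · have h1 : χ V = 0 := by
        simp only [hχ, Set.indicator_apply, Set.mem_compl_iff, hV, not_true_eq_false, if_false]
      have h2 : |Φ V| ≤ δ := hlaw V hV
      rw [h1, mul_zero, add_zero, ← sq_abs]
      exact pow_le_pow_left₀ (abs_nonneg _) h2 2
    · have h1 : χ V = 1 := by
        simp only [hχ, Set.indicator_apply, Set.mem_compl_iff, hV, not_false_eq_true, if_true]
      have h2 : Φ V ^ 2 ≤ M ^ 2 := by
        rw [← sq_abs]; exact pow_le_pow_left₀ (abs_nonneg _) (hM V) 2
      rw [h1, mul_one]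
      nlinarith [sq_nonneg δ]
  have hliftm : Measurable (torusLift (d := 4) (G := G) (2 * L + 1)) := (continuous_torusLift _).measurable
  have iΦ2 : Integrable (fun U : GaugeConfig 4 (2 * L + 1) G => Φ (torusLift (2 * L + 1) U) ^ 2)
      (wilsonMeasure (d := 4) (L := 2 * L + 1) r.ρ β) :=
    integrable_wilson_of_bdd r.ρ r.continuous β ((hΦc.measurable.comp hliftm).pow_const 2)
      ⟨M ^ 2, fun U => by rw [abs_pow]; exact pow_le_pow_left₀ (abs_nonneg _) (hM _) 2⟩
  have iχ : Integrable (fun U : GaugeConfig 4 (2 * L + 1) G => χ (torusLift (2 * L + 1) U))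
      (wilsonMeasure (d := 4) (L := 2 * L + 1) r.ρ β) :=
    integrable_wilson_of_bdd r.ρ r.continuous β ((measurable_const.indicator hGood.compl).comp hliftm)
      ⟨1, fun U => by rw [abs_of_nonneg (hχ0 _)]; exact hχ1 _⟩
  have ibound : Integrable (fun U : GaugeConfig 4 (2 * L + 1) G => δ ^ 2 + M ^ 2 * χ (torusLift (2 * L + 1) U))
      (wilsonMeasure (d := 4) (L := 2 * L + 1) r.ρ β) := (integrable_const _).add (iχ.const_mul _)
  unfold torusE at hrare ⊢
  change (∫ U, Φ (torusLift (2 * L + 1) U) ^ 2 ∂(wilsonMeasure (d := 4) (L := 2 * L + 1) r.ρ β)) ≤ δ ^ 2 + M ^ 2 * η₀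
  change (∫ U, χ (torusLift (2 * L + 1) U) ∂(wilsonMeasure (d := 4) (L := 2 * L + 1) r.ρ β)) ≤ η₀ at hrare
  have hmono : (∫ U, Φ (torusLift (2 * L + 1) U) ^ 2 ∂(wilsonMeasure (d := 4) (L := 2 * L + 1) r.ρ β)) ≤
      ∫ U, (δ ^ 2 + M ^ 2 * χ (torusLift (2 * L + 1) U)) ∂(wilsonMeasure (d := 4) (L := 2 * L + 1) r.ρ β) :=
    integral_mono iΦ2 ibound (fun U => hptw _)
  have hsum : (∫ U, (δ ^ 2 + M ^ 2 * χ (torusLift (2 * L + 1) U)) ∂(wilsonMeasure (d := 4) (L := 2 * L + 1) r.ρ β)) =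
      δ ^ 2 + M ^ 2 * ∫ U, χ (torusLift (2 * L + 1) U) ∂(wilsonMeasure (d := 4) (L := 2 * L + 1) r.ρ β) := by
    rw [integral_add (integrable_const _) (iχ.const_mul _), integral_const_mul, integral_const, smul_eq_mul,
      probReal_univ, one_mul]
  rw [hsum] at hmono
  nlinarith [sq_nonneg M, hmono, hrare]

/-! ## Asymptotic packaging along a unit map -/

/-- **`Q2(θv, v) ≥ ε` for all large couplings and tori from {MF, RBLΔ-L²}** (a unit map `a > 0`, ONE test function,
a positive-time cube family of physical size `≤ Λ₅` carrying the lattice support of `v(aβ·)` at depth `≥ 2`; the bare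
mirror floor `9ε/4` and the mean-square defect bound `ε/4` on every torus `aβ·L ≥ Λ₅`). [folklore] -/
theorem Q2_floor_of_bareFloor_l2 (a : ℝ → ℝ) (ha₀ : ∀ β, 0 < a β)
    (v : 𝓢(EuclideanSpace ℝ (Fin 4), ℝ)) {ε : ℝ} (hε : 0 < ε) {β₅ Λ₅ : ℝ}
    (c : ℝ → (Fin 4 → ℤ)) (b : ℝ → ℕ) (p' : ℝ → ℝ)
    (hgeom : ∀ β, β₅ ≤ β → 1 ≤ c β 0 ∧ ∀ j : Fin 4, (|((c β j : ℤ) : ℝ)| + (b β : ℝ) + 3) * a β ≤ Λ₅)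
    (hsupp : ∀ β, β₅ ≤ β → ∀ x : Fin 4 → ℤ, v (a β • siteToE x) ≠ 0 →
      x ∈ cubeSites (c β) (b β) ∧ 2 ≤ depth (c β) (b β) x)
    (hΔ2 : ∀ β, β₅ ≤ β → ∀ L : ℕ, Λ₅ ≤ a β * L →
      torusE G r β L (fun V => (kerE G r β (c β) (b β) V (fun V => ∑ x ∈ cubeSites (c β) (b β),
          v (a β • siteToE x) * ∑ q : {q : Fin 4 × Fin 4 // q.1 < q.2},
            plane G r q.1 (if q.1.1 = 0 then x - Pi.single 0 1 else x) V) -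
        kerE G r β (c β) (b β) V (fun V => ∑ y ∈ cubeSites (c β) (b β), v (a β • siteToE y) * dens G r y V) -
        p' β) ^ 2) ≤ ε / 4)
    (hMF : ∀ β, β₅ ≤ β → ∀ L : ℕ, Λ₅ ≤ a β * L →
      9 * ε / 4 ≤ torusE G r β L (fun V =>
          (∑ y ∈ cubeSites (c β) (b β), v (a β • siteToE y) * dens G r y (cfgReflect V)) *
            ∑ y ∈ cubeSites (c β) (b β), v (a β • siteToE y) * dens G r y V) -
        torusE G r β L (fun V => ∑ y ∈ cubeSites (c β) (b β), v (a β • siteToE y) * dens G r y (cfgReflect V)) *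
          torusE G r β L (fun V => ∑ y ∈ cubeSites (c β) (b β), v (a β • siteToE y) * dens G r y V)) :
    ∀ β : ℝ, max β₅ 0 ≤ β → ∀ L : ℕ, Λ₅ ≤ a β * L → ε ≤ Q2 G r β L (a β) (thetaTest 4 v) v := by
  intro β hβ L hL
  have hβ₅ : β₅ ≤ β := le_trans (le_max_left _ _) hβ
  have hβ0 : 0 ≤ β := le_trans (le_max_right _ _) hβ
  obtain ⟨hc0, hsize⟩ := hgeom β hβ₅
  obtain ⟨hcL, hc⟩ := torusFit_of_geom (ha₀ β) hsize hL
  exact Q2_ge_of_bareFloor_l2 G r hβ0 (c β) (b β) L hc0 hcL hc (a β) v (hsupp β hβ₅) hε (hMF β hβ₅ L hL)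
    (hΔ2 β hβ₅ L hL)

/-- **Clause (i) of `LowerBounds G r a` from {MF, RBLΔ-L²}.** [folklore] -/
theorem lowerBounds_fst_of_bareFloor_l2 (a : ℝ → ℝ) (ha₀ : ∀ β, 0 < a β)
    (v : 𝓢(EuclideanSpace ℝ (Fin 4), ℝ)) (hv : tsupport (v : EuclideanSpace ℝ (Fin 4) → ℝ) ⊆ {y | 0 < y 0})
    {ε : ℝ} (hε : 0 < ε) {β₅ Λ₅ : ℝ}
    (c : ℝ → (Fin 4 → ℤ)) (b : ℝ → ℕ) (p' : ℝ → ℝ)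
    (hgeom : ∀ β, β₅ ≤ β → 1 ≤ c β 0 ∧ ∀ j : Fin 4, (|((c β j : ℤ) : ℝ)| + (b β : ℝ) + 3) * a β ≤ Λ₅)
    (hsupp : ∀ β, β₅ ≤ β → ∀ x : Fin 4 → ℤ, v (a β • siteToE x) ≠ 0 →
      x ∈ cubeSites (c β) (b β) ∧ 2 ≤ depth (c β) (b β) x)
    (hΔ2 : ∀ β, β₅ ≤ β → ∀ L : ℕ, Λ₅ ≤ a β * L →
      torusE G r β L (fun V => (kerE G r β (c β) (b β) V (fun V => ∑ x ∈ cubeSites (c β) (b β),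
          v (a β • siteToE x) * ∑ q : {q : Fin 4 × Fin 4 // q.1 < q.2},
            plane G r q.1 (if q.1.1 = 0 then x - Pi.single 0 1 else x) V) -
        kerE G r β (c β) (b β) V (fun V => ∑ y ∈ cubeSites (c β) (b β), v (a β • siteToE y) * dens G r y V) -
        p' β) ^ 2) ≤ ε / 4)
    (hMF : ∀ β, β₅ ≤ β → ∀ L : ℕ, Λ₅ ≤ a β * L →
      9 * ε / 4 ≤ torusE G r β L (fun V =>
          (∑ y ∈ cubeSites (c β) (b β), v (a β • siteToE y) * dens G r y (cfgReflect V)) *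
            ∑ y ∈ cubeSites (c β) (b β), v (a β • siteToE y) * dens G r y V) -
        torusE G r β L (fun V => ∑ y ∈ cubeSites (c β) (b β), v (a β • siteToE y) * dens G r y (cfgReflect V)) *
          torusE G r β L (fun V => ∑ y ∈ cubeSites (c β) (b β), v (a β • siteToE y) * dens G r y V)) :
    ∃ (v : 𝓢(EuclideanSpace ℝ (Fin 4), ℝ)) (ε β₅ Λ₅ : ℝ),
      tsupport (v : EuclideanSpace ℝ (Fin 4) → ℝ) ⊆ {y : EuclideanSpace ℝ (Fin 4) | 0 < y 0} ∧ 0 < ε ∧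
      ∀ β : ℝ, β₅ ≤ β → ∀ L : ℕ, Λ₅ ≤ a β * L → ε ≤ Q2 G r β L (a β) (thetaTest 4 v) v :=
  ⟨v, ε, max β₅ 0, Λ₅, hv, hε, Q2_floor_of_bareFloor_l2 G r a ha₀ v hε c b p' hgeom hsupp hΔ2 hMF⟩

/-- **The two-point conjunct of `UVSeamRec.stub_floorsEngine` (v4-F) from {MF, RBLΔ-L²}** (compact support recorded;
any `(G, r, a)`). [folklore] -/
theorem floorsTwoPoint_of_bareFloor_l2 (a : ℝ → ℝ) (ha₀ : ∀ β, 0 < a β)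
    (v : 𝓢(EuclideanSpace ℝ (Fin 4), ℝ)) (hvK : HasCompactSupport (v : EuclideanSpace ℝ (Fin 4) → ℝ))
    (hv : tsupport (v : EuclideanSpace ℝ (Fin 4) → ℝ) ⊆ {y | 0 < y 0})
    {ε : ℝ} (hε : 0 < ε) {β₅ Λ₅ : ℝ}
    (c : ℝ → (Fin 4 → ℤ)) (b : ℝ → ℕ) (p' : ℝ → ℝ)
    (hgeom : ∀ β, β₅ ≤ β → 1 ≤ c β 0 ∧ ∀ j : Fin 4, (|((c β j : ℤ) : ℝ)| + (b β : ℝ) + 3) * a β ≤ Λ₅)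
    (hsupp : ∀ β, β₅ ≤ β → ∀ x : Fin 4 → ℤ, v (a β • siteToE x) ≠ 0 →
      x ∈ cubeSites (c β) (b β) ∧ 2 ≤ depth (c β) (b β) x)
    (hΔ2 : ∀ β, β₅ ≤ β → ∀ L : ℕ, Λ₅ ≤ a β * L →
      torusE G r β L (fun V => (kerE G r β (c β) (b β) V (fun V => ∑ x ∈ cubeSites (c β) (b β),
          v (a β • siteToE x) * ∑ q : {q : Fin 4 × Fin 4 // q.1 < q.2},
            plane G r q.1 (if q.1.1 = 0 then x - Pi.single 0 1 else x) V) -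
        kerE G r β (c β) (b β) V (fun V => ∑ y ∈ cubeSites (c β) (b β), v (a β • siteToE y) * dens G r y V) -
        p' β) ^ 2) ≤ ε / 4)
    (hMF : ∀ β, β₅ ≤ β → ∀ L : ℕ, Λ₅ ≤ a β * L →
      9 * ε / 4 ≤ torusE G r β L (fun V =>
          (∑ y ∈ cubeSites (c β) (b β), v (a β • siteToE y) * dens G r y (cfgReflect V)) *
            ∑ y ∈ cubeSites (c β) (b β), v (a β • siteToE y) * dens G r y V) -
        torusE G r β L (fun V => ∑ y ∈ cubeSites (c β) (b β), v (a β • siteToE y) * dens G r y (cfgReflect V)) *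
          torusE G r β L (fun V => ∑ y ∈ cubeSites (c β) (b β), v (a β • siteToE y) * dens G r y V)) :
    ∃ (v : 𝓢(EuclideanSpace ℝ (Fin 4), ℝ)) (ε β₅ Λ₅ : ℝ),
      HasCompactSupport (v : EuclideanSpace ℝ (Fin 4) → ℝ) ∧
      tsupport (v : EuclideanSpace ℝ (Fin 4) → ℝ) ⊆ {y : EuclideanSpace ℝ (Fin 4) | 0 < y 0} ∧ 0 < ε ∧
      ∀ β : ℝ, β₅ ≤ β → ∀ L : ℕ, Λ₅ ≤ a β * L → ε ≤ Q2 G r β L (a β) (thetaTest 4 v) v :=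
  ⟨v, ε, max β₅ 0, Λ₅, hvK, hv, hε, Q2_floor_of_bareFloor_l2 G r a ha₀ v hε c b p' hgeom hsupp hΔ2 hMF⟩

/-- **Along a unit map, converse**: (RBLΔ-L²) and a floor `ε ≤ Q2_{β,L,aβ}(θv, v)` for `β ≥ β₅`, `Λ₅ ≤ aβ·L` force
the bare mirror floor `ε/2` for `β ≥ max β₅ 0`. [folklore] -/
theorem bareFloors_of_Q2_floors_l2 (a : ℝ → ℝ) (ha₀ : ∀ β, 0 < a β)
    (v : 𝓢(EuclideanSpace ℝ (Fin 4), ℝ)) {ε : ℝ} (hε : 0 < ε) {β₅ Λ₅ : ℝ}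
    (c : ℝ → (Fin 4 → ℤ)) (b : ℝ → ℕ) (p' : ℝ → ℝ)
    (hgeom : ∀ β, β₅ ≤ β → 1 ≤ c β 0 ∧ ∀ j : Fin 4, (|((c β j : ℤ) : ℝ)| + (b β : ℝ) + 3) * a β ≤ Λ₅)
    (hsupp : ∀ β, β₅ ≤ β → ∀ x : Fin 4 → ℤ, v (a β • siteToE x) ≠ 0 →
      x ∈ cubeSites (c β) (b β) ∧ 2 ≤ depth (c β) (b β) x)
    (hΔ2 : ∀ β, β₅ ≤ β → ∀ L : ℕ, Λ₅ ≤ a β * L →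
      torusE G r β L (fun V => (kerE G r β (c β) (b β) V (fun V => ∑ x ∈ cubeSites (c β) (b β),
          v (a β • siteToE x) * ∑ q : {q : Fin 4 × Fin 4 // q.1 < q.2},
            plane G r q.1 (if q.1.1 = 0 then x - Pi.single 0 1 else x) V) -
        kerE G r β (c β) (b β) V (fun V => ∑ y ∈ cubeSites (c β) (b β), v (a β • siteToE y) * dens G r y V) -
        p' β) ^ 2) ≤ ε / 4)
    (hQ : ∀ β, β₅ ≤ β → ∀ L : ℕ, Λ₅ ≤ a β * L → ε ≤ Q2 G r β L (a β) (thetaTest 4 v) v) :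
    ∀ β, max β₅ 0 ≤ β → ∀ L : ℕ, Λ₅ ≤ a β * L →
      ε / 2 ≤ torusE G r β L (fun V =>
          (∑ y ∈ cubeSites (c β) (b β), v (a β • siteToE y) * dens G r y (cfgReflect V)) *
            ∑ y ∈ cubeSites (c β) (b β), v (a β • siteToE y) * dens G r y V) -
        torusE G r β L (fun V => ∑ y ∈ cubeSites (c β) (b β), v (a β • siteToE y) * dens G r y (cfgReflect V)) *
          torusE G r β L (fun V => ∑ y ∈ cubeSites (c β) (b β), v (a β • siteToE y) * dens G r y V) := by
  intro β hβ L hL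
  have hβ₅ : β₅ ≤ β := le_trans (le_max_left _ _) hβ
  have hβ0 : 0 ≤ β := le_trans (le_max_right _ _) hβ
  obtain ⟨hc0, hsize⟩ := hgeom β hβ₅
  obtain ⟨hcL, hc⟩ := torusFit_of_geom (ha₀ β) hsize hL
  exact bareFloor_of_Q2_floor_l2 G r hβ0 (c β) (b β) L hc0 hcL hc (a β) v (hsupp β hβ₅) hε (hΔ2 β hβ₅ L hL)
    (hQ β hβ₅ L hL)

end TypicalPackage

/-- **`NT` BY NAME from {MF, RBLΔ-L²} and any clause-(ii) supplier** (every compact simple `G`, Borel σ-algebra).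
[folklore] -/
theorem nt_of_bareFloor_l2
    (h : ∀ (G : Type) [Group G] [TopologicalSpace G] [IsTopologicalGroup G] [CompactSpace G],
      IsCompactSimpleLieGroup G → letI : MeasurableSpace G := borel G; haveI : BorelSpace G := ⟨rfl⟩;
      ∃ (r : LatticeRep G) (a : ℝ → ℝ), (∀ β, 0 < a β) ∧ Tendsto a atTop (𝓝 0) ∧
        (∃ (v : 𝓢(EuclideanSpace ℝ (Fin 4), ℝ)) (ε β₅ Λ₅ : ℝ) (c : ℝ → (Fin 4 → ℤ)) (b : ℝ → ℕ) (p' : ℝ → ℝ),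
          tsupport (v : EuclideanSpace ℝ (Fin 4) → ℝ) ⊆ {y | 0 < y 0} ∧ 0 < ε ∧
          (∀ β, β₅ ≤ β → 1 ≤ c β 0 ∧ ∀ j : Fin 4, (|((c β j : ℤ) : ℝ)| + (b β : ℝ) + 3) * a β ≤ Λ₅) ∧
          (∀ β, β₅ ≤ β → ∀ x : Fin 4 → ℤ, v (a β • siteToE x) ≠ 0 →
            x ∈ cubeSites (c β) (b β) ∧ 2 ≤ depth (c β) (b β) x) ∧
          (∀ β, β₅ ≤ β → ∀ L : ℕ, Λ₅ ≤ a β * L →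
            torusE G r β L (fun V => (kerE G r β (c β) (b β) V (fun V => ∑ x ∈ cubeSites (c β) (b β),
                v (a β • siteToE x) * ∑ q : {q : Fin 4 × Fin 4 // q.1 < q.2},
                  plane G r q.1 (if q.1.1 = 0 then x - Pi.single 0 1 else x) V) -
              kerE G r β (c β) (b β) V (fun V => ∑ y ∈ cubeSites (c β) (b β), v (a β • siteToE y) * dens G r y V) -
              p' β) ^ 2) ≤ ε / 4) ∧
          (∀ β, β₅ ≤ β → ∀ L : ℕ, Λ₅ ≤ a β * L →
            9 * ε / 4 ≤ torusE G r β L (fun V =>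
                (∑ y ∈ cubeSites (c β) (b β), v (a β • siteToE y) * dens G r y (cfgReflect V)) *
                  ∑ y ∈ cubeSites (c β) (b β), v (a β • siteToE y) * dens G r y V) -
              torusE G r β L (fun V => ∑ y ∈ cubeSites (c β) (b β), v (a β • siteToE y) * dens G r y (cfgReflect V)) *
                torusE G r β L (fun V => ∑ y ∈ cubeSites (c β) (b β), v (a β • siteToE y) * dens G r y V))) ∧
        (∃ (f g h : 𝓢(EuclideanSpace ℝ (Fin 4), ℝ)) (ε β₅ Λ₅ : ℝ), Disjoint (tsupport f) (tsupport g) ∧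
          Disjoint (tsupport g) (tsupport h) ∧ Disjoint (tsupport f) (tsupport h) ∧ 0 < ε ∧
          ∀ β : ℝ, β₅ ≤ β → ∀ L : ℕ, Λ₅ ≤ a β * L → ε ≤ |Q3 G r β L (a β) f g h|)) :
    Summit.QuantumFields.YangMills.Theses.BalabanLadder.NT := by
  intro G _ _ _ _ hG
  letI : MeasurableSpace G := borel G
  haveI : BorelSpace G := ⟨rfl⟩
  obtain ⟨r, a, ha₀, ha, ⟨v, ε, β₅, Λ₅, c, b, p', hv, hε, hgeom, hsupp, hΔ2, hMF⟩, h3⟩ := h G hG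
  exact ⟨r, a, ha₀, ha, lowerBounds_fst_of_bareFloor_l2 G r a ha₀ v hv hε c b p' hgeom hsupp hΔ2 hMF, h3⟩

end Summit.QuantumFields.YangMills.Cruxes.NT.MarkovMirror

end
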